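import Mathlib
import Literature.Analysis.FluidPDE.LeraySelfSimilarCalculus
import Literature.Analysis.FluidPDE.WeakSolution
import Summits.NavierStokesRegularity.OSWSelfSimilar.TypeIIModulationDictionary
import HarnessLib
/-!
# The MODULATED similarity ansatz is an EXACT change of variables (zone Z1 TEMPLATE §T1.0 (E1)–(E2), (Z1-E) — kernel-checked)

HONEST FRAMING (cell ns-blowup GROUP B «PROFILE SEARCH», zone Z1 «Type-II log-modulated DSS ansatz for axisymmetric
Navier–Stokes — the template IS the deliverable»; D-0035/D-0074): part III of the Z1 dictionary (parts I/II:
`TypeIIModulationDictionary`, `TypeIIModulationLawClasses`). It kernel-checks the template's defining identity: for ANY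
positive scale `λ(t)`, centre `x*(t)` and clock `τ(t)` with `dτ/dt = λ⁻²`, the substitution
`u(x, t) = λ(t)⁻¹ V(τ(t), (x − x*(t))/λ(t))` (TEMPLATE (E1); the Navier–Stokes-invariant scaling with a TIME-DEPENDENT scale)
turns the time derivative into `∂ₜu = λ⁻³[∂_τV + a ΛV + ζ·∇_yV]` EXACTLY, with the MODULATION `a = −λλ̇`, `ΛV = V + y·∇V`
and the drift `ζ = −λ ẋ*` (TEMPLATE (E2)), and — in the symmetric class `x* ≡ 0` (TEMPLATE (E8), the class of every Z1 run) —
the whole momentum operator into `λ⁻³ • [∂_τV + aΛV + (V·∇)V + ∇Π − νΔV]` (TEMPLATE (Z1-E): the viscosity coefficient stays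
`ν`; the price of a free `λ(t)` is the modulation term `aΛV` — contrast the tree's constant-exponent
`Literature.Analysis.FluidPDE.SelfSimilarCollapseAnsatz`, where the scale law is rigid and the viscosity drifts as `ν_eff`).
**Nothing here is a statement about Navier–Stokes solutions**: these are chain-rule identities valid for every smooth `V`;
no solution, profile or blow-up is asserted. m1 of the Z1 meter («TRUE B: an exact change of variables, no modes discarded»)
is exactly what is checked. «violates: n/a — dictionary»; bears_on LADDER-NS N5/Z1 → N1 linear core / N0⁻.

* `hasDerivAt_modulatedAnsatz_time` — (E2) for a general centre `x*(t)`: with `y = (x − x*(t))/λ(t)` and `L = DV(τ, y)`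
  (the Fréchet derivative of `V : ℝ × E → F` in `(τ, y)` jointly; `∂_τV = L(1,0)`, `∇_yV·w = L(0,w)`),
  `d/dt [λ⁻¹ V(τ(t), y(t))] = λ⁻³ • (L(1,0) + (−λλ̇) • (V + L(0,y)) + L(0, (−λẋ*)))`.
* `hasDerivAt_modulatedAnsatz_time_centered` — the same with `x* ≡ 0` (no drift term).
* `fderiv_slice_eq` — the spatial slice `V(τ, ·)` has derivative `w ↦ L(0, w)`.
* `ns_momentum_modulatedAnsatz` — (Z1-E) on `ℝ³`, `x* ≡ 0`: for `u(s, z) = λ(s)⁻¹ V(τ(s), z/λ(s))`,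
  `p(s, z) = λ(s)⁻² Π(τ(s), z/λ(s))`:
  `∂ₜu + (u·∇)u + ∇p − νΔu = λ⁻³ • [L(1,0) + (−λλ̇) • (V + DV·y) + DV·V + ∇Π − ν ΔV](τ, y)`,
  using the tree's dilation lemmas `convect_smul_comp_smul`, `laplacian_smul_comp_smul`, `gradient_sq_mul_comp_smul_sub`
  (`Literature.Analysis.FluidPDE.LeraySelfSimilarCalculus`) at the frozen time `t` with `c = λ(t)⁻¹`.

WHAT IS NOT HERE: divergence (it is `div u = λ⁻² div_y V`, the tree's `divergence_smul_comp_smul`), the axisymmetric component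
form (E4)–(E7), and any solution. Author: ns-blowup-profile-eng-1 g4, 2026-08-26.
-/

open Real Filter Topology Set InnerProductSpace
open scoped Laplacian RealInnerProductSpace
open Literature.Analysis.FluidPDE

namespace Summit.NavierStokesRegularity.OSWSelfSimilar
namespace TypeIIModulationDictionary

section TimeDerivative

variable {E : Type*} [NormedAddCommGroup E] [NormedSpace ℝ E]
variable {F : Type*} [NormedAddCommGroup F] [NormedSpace ℝ F]

/-- **TEMPLATE (E2), general centre.** Let `λ` have derivative `λ̇` at `t` with `λ(t) ≠ 0`, the clock `τ` have derivative
`λ(t)⁻²` at `t`, the centre `x*` have derivative `ẋ*` at `t`, and `V : ℝ × E → F` be Fréchet-differentiable at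
`(τ(t), y)`, `y := λ(t)⁻¹ • (x − x*(t))`, with derivative `L`. Then the modulated ansatz
`s ↦ λ(s)⁻¹ • V(τ(s), λ(s)⁻¹ • (x − x*(s)))` has time derivative
`λ(t)⁻³ • (L(1,0) + (−λ(t)λ̇) • (V(τ,y) + L(0,y)) + L(0, (−λ(t)) • ẋ*))` at `t` — i.e.
`∂ₜu = λ⁻³[∂_τV + a ΛV + ζ·∇V]` with `a = −λλ̇`, `ΛV = V + y·∇V`, `ζ = −λẋ*`. (Chain and product rules.) [new here — dictionary] -/
theorem hasDerivAt_modulatedAnsatz_time {lam τc : ℝ → ℝ} {xc : ℝ → E} {V : ℝ × E → F}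
    {L : ℝ × E →L[ℝ] F} {dlam : ℝ} {dxc : E} {t : ℝ} {x : E}
    (hlam : HasDerivAt lam dlam t) (hne : lam t ≠ 0) (hτ : HasDerivAt τc ((lam t)⁻¹ ^ 2) t)
    (hxc : HasDerivAt xc dxc t) (hV : HasFDerivAt V L (τc t, (lam t)⁻¹ • (x - xc t))) :
    HasDerivAt (fun s => (lam s)⁻¹ • V (τc s, (lam s)⁻¹ • (x - xc s)))
      ((lam t)⁻¹ ^ 3 • (L (1, 0)
        + (-(lam t * dlam)) • (V (τc t, (lam t)⁻¹ • (x - xc t)) + L (0, (lam t)⁻¹ • (x - xc t)))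
        + L (0, (-lam t) • dxc))) t := by
  have h_inv : HasDerivAt (fun s => (lam s)⁻¹) (-dlam / (lam t) ^ 2) t := hlam.inv hne
  have h_sub : HasDerivAt (fun s => x - xc s) (-dxc) t := hxc.const_sub x
  have h_y : HasDerivAt (fun s => (lam s)⁻¹ • (x - xc s))
      ((lam t)⁻¹ • (-dxc) + (-dlam / (lam t) ^ 2) • (x - xc t)) t := h_inv.smul h_sub
  have h_in : HasDerivAt (fun s => (τc s, (lam s)⁻¹ • (x - xc s)))
      ((lam t)⁻¹ ^ 2, (lam t)⁻¹ • (-dxc) + (-dlam / (lam t) ^ 2) • (x - xc t)) t := hτ.prodMk h_y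
  have h_comp : HasDerivAt (fun s => V (τc s, (lam s)⁻¹ • (x - xc s)))
      (L ((lam t)⁻¹ ^ 2, (lam t)⁻¹ • (-dxc) + (-dlam / (lam t) ^ 2) • (x - xc t))) t :=
    hV.comp_hasDerivAt t h_in
  have h_all := h_inv.smul h_comp
  refine h_all.congr_deriv ?_
  -- linearity bookkeeping for `L`
  have hsplit : ∀ (r : ℝ) (w : E), L (r, w) = r • L (1, 0) + L (0, w) := by
    intro r w
    rw [← map_smul, ← map_add]
    congr 1
    ext <;> simp
  have hL0add : ∀ w w' : E, L (0, w + w') = L (0, w) + L (0, w') := by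
    intro w w'
    rw [← map_add, Prod.mk_add_mk, add_zero]
  have hL0smul : ∀ (c : ℝ) (w : E), L (0, c • w) = c • L (0, w) := by
    intro c w
    rw [← map_smul, Prod.smul_mk, smul_zero]
  -- rewrite the explicit `x - xc t` inside the derivative of `y`
  have hyder : (lam t)⁻¹ • (-dxc) + (-dlam / (lam t) ^ 2) • (x - xc t)
      = (-(lam t)⁻¹) • dxc + (-dlam / lam t) • ((lam t)⁻¹ • (x - xc t)) := by
    rw [smul_smul, smul_neg, neg_smul]
    congr 1
    field_simp
  rw [hyder, hsplit]
  simp only [hL0add, hL0smul]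
  match_scalars <;> field_simp

/-- **TEMPLATE (E2) in the symmetric class `x* ≡ 0`** (TEMPLATE (E8): `S_z`, one gauge function; every Z1 run): the time
derivative of `s ↦ λ(s)⁻¹ • V(τ(s), λ(s)⁻¹ • x)` at `t` is `λ⁻³ • (L(1,0) + (−λλ̇) • (V(τ,y) + L(0,y)))`, `y = λ(t)⁻¹ • x`.
[new here — dictionary] -/
theorem hasDerivAt_modulatedAnsatz_time_centered {lam τc : ℝ → ℝ} {V : ℝ × E → F}
    {L : ℝ × E →L[ℝ] F} {dlam : ℝ} {t : ℝ} {x : E}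
    (hlam : HasDerivAt lam dlam t) (hne : lam t ≠ 0) (hτ : HasDerivAt τc ((lam t)⁻¹ ^ 2) t)
    (hV : HasFDerivAt V L (τc t, (lam t)⁻¹ • x)) :
    HasDerivAt (fun s => (lam s)⁻¹ • V (τc s, (lam s)⁻¹ • x))
      ((lam t)⁻¹ ^ 3 • (L (1, 0)
        + (-(lam t * dlam)) • (V (τc t, (lam t)⁻¹ • x) + L (0, (lam t)⁻¹ • x)))) t := by
  have hxc : HasDerivAt (fun _ : ℝ => (0 : E)) 0 t := hasDerivAt_const t 0
  have hV' : HasFDerivAt V L (τc t, (lam t)⁻¹ • (x - (fun _ : ℝ => (0 : E)) t)) := by simpa using hV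
  have h := hasDerivAt_modulatedAnsatz_time hlam hne hτ hxc hV'
  simp only [sub_zero, smul_zero] at h
  have h0 : L (0, (0 : E)) = 0 := by rw [← Prod.zero_eq_mk, map_zero]
  rw [h0, add_zero] at h
  exact h

/-- **The spatial slice.** If `V : ℝ × E → F` has Fréchet derivative `L` at `(τ, y)`, the frozen-time field `V(τ, ·)` has
derivative `w ↦ L(0, w)` at `y`: `fderiv (fun w => V (τ, w)) y w = L (0, w)`. [new here — dictionary] -/
theorem fderiv_slice_eq {V : ℝ × E → F} {L : ℝ × E →L[ℝ] F} {τ : ℝ} {y : E} (hV : HasFDerivAt V L (τ, y)) (w : E) :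
    fderiv ℝ (fun w => V (τ, w)) y w = L (0, w) := by
  have h : HasFDerivAt (fun w => V (τ, w)) (L.comp (ContinuousLinearMap.inr ℝ ℝ E)) y :=
    hV.comp y (hasFDerivAt_prodMk_right τ y)
  rw [h.fderiv]
  simp

end TimeDerivative

section Momentum

/-- **TEMPLATE (Z1-E) on `ℝ³`, symmetric class `x* ≡ 0`: the Navier–Stokes momentum operator on the modulated ansatz.**
Let `u(s, z) := λ(s)⁻¹ • V(τ(s), λ(s)⁻¹ • z)`, `p(s, z) := λ(s)⁻² Π(τ(s), λ(s)⁻¹ • z)` with `λ(t) ≠ 0`, `λ̇ = dλ/dt`,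
`dτ/dt = λ⁻²` at `t`, `V : ℝ × ℝ³ → ℝ³` Fréchet-differentiable at `(τ(t), y)` with derivative `L`, `y := λ(t)⁻¹ • x`, and
the slice `V(τ(t), ·)` of class `C²`. Then, with `DV := fderiv (V(τ(t), ·)) y`,
`∂ₜu + (u·∇)u + ∇p − νΔu` at `(t, x)` `=` `λ(t)⁻³ • [L(1,0) + (−λλ̇) • (V + DV y) + DV (V) + ∇Π − ν ΔV]` at `(τ(t), y)` —
every term, INCLUDING the viscous one, carries the same factor `λ⁻³` (ν = const survives; the modulation `a = −λλ̇`
multiplies `ΛV = V + DV y`). Chain rule + the tree's dilation lemmas; no equation is assumed. [new here — dictionary] -/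
theorem ns_momentum_modulatedAnsatz {lam τc : ℝ → ℝ}
    {V : ℝ × EuclideanSpace ℝ (Fin 3) → EuclideanSpace ℝ (Fin 3)} {Pr : ℝ × EuclideanSpace ℝ (Fin 3) → ℝ}
    {L : ℝ × EuclideanSpace ℝ (Fin 3) →L[ℝ] EuclideanSpace ℝ (Fin 3)} {dlam : ℝ} {t : ℝ} (ν : ℝ)
    (x : EuclideanSpace ℝ (Fin 3))
    (hlam : HasDerivAt lam dlam t) (hne : lam t ≠ 0) (hτ : HasDerivAt τc ((lam t)⁻¹ ^ 2) t)
    (hV : HasFDerivAt V L (τc t, (lam t)⁻¹ • x)) (hV2 : ContDiff ℝ 2 (fun w => V (τc t, w))) :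
    timeDeriv (fun s z => (lam s)⁻¹ • V (τc s, (lam s)⁻¹ • z)) t x
        + convect (fun z => (lam t)⁻¹ • V (τc t, (lam t)⁻¹ • z)) (fun z => (lam t)⁻¹ • V (τc t, (lam t)⁻¹ • z)) x
        + gradient (fun z => (lam t)⁻¹ ^ 2 * Pr (τc t, (lam t)⁻¹ • z)) x
        - ν • (Δ (fun z => (lam t)⁻¹ • V (τc t, (lam t)⁻¹ • z))) x
      = (lam t)⁻¹ ^ 3 •
        (L (1, 0)
          + (-(lam t * dlam)) • (V (τc t, (lam t)⁻¹ • x)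
              + fderiv ℝ (fun w => V (τc t, w)) ((lam t)⁻¹ • x) ((lam t)⁻¹ • x))
          + fderiv ℝ (fun w => V (τc t, w)) ((lam t)⁻¹ • x) (V (τc t, (lam t)⁻¹ • x))
          + gradient (fun w => Pr (τc t, w)) ((lam t)⁻¹ • x)
          - ν • (Δ (fun w => V (τc t, w))) ((lam t)⁻¹ • x)) := by
  set c : ℝ := (lam t)⁻¹ with hc
  -- time derivative
  have ht : timeDeriv (fun s z => (lam s)⁻¹ • V (τc s, (lam s)⁻¹ • z)) t x
      = c ^ 3 • (L (1, 0) + (-(lam t * dlam)) • (V (τc t, c • x) + L (0, c • x))) := by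
    rw [timeDeriv_apply]
    exact (hasDerivAt_modulatedAnsatz_time_centered hlam hne hτ hV).deriv
  -- convective term, Laplacian, pressure gradient: the tree's dilation lemmas with `U = V(τ(t), ·)`
  have hconv : convect (fun z => c • V (τc t, c • z)) (fun z => c • V (τc t, c • z)) x
      = c ^ 3 • convect (fun w => V (τc t, w)) (fun w => V (τc t, w)) (c • x) :=
    convect_smul_comp_smul (fun w => V (τc t, w)) c x
  have hlap : (Δ (fun z => c • V (τc t, c • z))) x = c ^ 3 • (Δ (fun w => V (τc t, w))) (c • x) :=
    laplacian_smul_comp_smul hV2 c x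
  have hgrad : gradient (fun z => c ^ 2 * Pr (τc t, c • z)) x = c ^ 3 • gradient (fun w => Pr (τc t, w)) (c • x) := by
    have h1 : (fun z => c ^ 2 * Pr (τc t, c • z)) = fun z => c ^ 2 * ((fun w => Pr (τc t, w)) (c • z) - 0) := by
      funext z; simp
    rw [h1, gradient_sq_mul_comp_smul_sub (fun w => Pr (τc t, w)) c 0 x]
  rw [ht, hconv, hlap, hgrad, convect, fderiv_slice_eq hV (c • x)]
  rw [smul_comm ν (c ^ 3)]
  simp only [smul_add, smul_sub]

end Momentum

end TypeIIModulationDictionary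
end Summit.NavierStokesRegularity.OSWSelfSimilar
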